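import Literature.Probability.Process.BrownianMotionComplexProofs
import Literature.Probability.Process.PathSpaceBorel
import Mathlib.Topology.UnitInterval
import HarnessLib

/-!
# The law of a planar Brownian path is unique

For the planar (complex) Brownian motion predicate
`Literature.Probability.Process.IsBrownianComplex Z P` (real and imaginary parts are real
Brownian motions, independent as path-valued random variables) we prove that the
finite-dimensional distributions, and hence the law of the path as a random element of the path
spaces `C(ℝ≥0, ℂ)` and `C([0,1], ℂ)` (Borel σ-algebra of the compact-open = locally uniform
topology), do not depend on the realisation:

* `IsBrownianComplex.map_fdd_eq_map_prod`, `IsBrownianComplex.map_fdd_eq` — for finitely many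
  times `τ i`, the law of `ω ↦ (Z_{τ i}(ω))_i` is the image of the product of two copies of
  Mathlib's Gaussian `ProbabilityTheory.projectiveFamily` under `((x_i), (y_i)) ↦ (x_i + iy_i)`,
  hence the same for any two planar Brownian motions (with measurable marginals);
* `IsBrownianComplex.map_path_eq`, `IsBrownianComplex.map_unitIntervalPath_eq` — the laws of
  `ω ↦ (t ↦ Z_t ω)` on `C(ℝ≥0, ℂ)`, resp. of `ω ↦ (t ↦ Z_t ω)_{t ∈ [0,1]}` on `C([0,1], ℂ)`, agree
  for any two planar Brownian motions with continuous paths (a finite Borel measure on `C(α, β)`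
  is determined by its finite-dimensional distributions,
  `Literature.Probability.Process.measure_continuousMap_ext_of_fdd`).

This is the uniqueness half of "Wiener measure" for the planar motion (Kallenberg 2002,
Lemma 13.1: a Gaussian process is determined in law by its mean and covariance; Billingsley
1999, Example 1.3: the finite-dimensional sets form a separating class of `C`), in the form
consumed by invariance principles whose limit is "any planar Brownian motion"
(e.g. `Literature.Barriers.CriticalPhenomena.Edwards2D.Stoll1989_invariance`).

## References

* O. Kallenberg, *Foundations of Modern Probability* (2nd ed. 2002), Lemma 13.1, Thm. 13.5.
* P. Billingsley, *Convergence of Probability Measures* (2nd ed. 1999), Example 1.3 and §7.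
-/

noncomputable section

open MeasureTheory ProbabilityTheory ProbabilityTheory.BrownianReal
open scoped NNReal ENNReal Topology

namespace Literature.Probability.Process

variable {Ω : Type*} [MeasurableSpace Ω] {P : Measure Ω} {Z : ℝ≥0 → Ω → ℂ}
  {Ω' : Type*} [MeasurableSpace Ω'] {P' : Measure Ω'} {Z' : ℝ≥0 → Ω' → ℂ}

/-- Assembling real and imaginary parts coordinatewise, `((x_i), (y_i)) ↦ (x_i + i y_i)`, is a
measurable map `(ι → ℝ) × (ι → ℝ) → (ι → ℂ)`. [folklore] -/
theorem measurable_piComplexMk {ι : Type*} :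
    Measurable fun p : (ι → ℝ) × (ι → ℝ) => fun i => (⟨p.1 i, p.2 i⟩ : ℂ) :=
  measurable_pi_lambda _ fun i =>
    measurable_complexMk ((measurable_pi_apply i).comp measurable_fst)
      ((measurable_pi_apply i).comp measurable_snd)

/-- **The finite-dimensional distributions of a planar Brownian motion, explicitly**: for times
`τ : ι → ℝ≥0` (`ι` finite), the law of `ω ↦ (Z_{τ i} ω)_i` is the image of the product of two
copies of the Gaussian projective family at the times `{τ i}` under re-indexing and
`((x_i), (y_i)) ↦ (x_i + iy_i)` — independence of real and imaginary parts plus Mathlib's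
`IsPreBrownianReal.hasLaw`. [cite: Kallenberg2002, Lemma 13.1 and Thm. 13.5] -/
theorem IsBrownianComplex.map_fdd_eq_map_prod [IsProbabilityMeasure P] {ι : Type*} [Fintype ι]
    [DecidableEq ℝ≥0] (τ : ι → ℝ≥0) (hZ : IsBrownianComplex Z P) (hm : ∀ t, Measurable (Z t)) :
    P.map (fun ω i => Z (τ i) ω) =
      (((projectiveFamily (Finset.univ.image τ)).map fun (f : ↥(Finset.univ.image τ) → ℝ)
          (i : ι) => f ⟨τ i, Finset.mem_image_of_mem τ (Finset.mem_univ i)⟩).prod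
        ((projectiveFamily (Finset.univ.image τ)).map fun (f : ↥(Finset.univ.image τ) → ℝ)
          (i : ι) => f ⟨τ i, Finset.mem_image_of_mem τ (Finset.mem_univ i)⟩)).map
        fun p : (ι → ℝ) × (ι → ℝ) => fun i => (⟨p.1 i, p.2 i⟩ : ℂ) := by
  set I : Finset ℝ≥0 := Finset.univ.image τ with hI
  set ρ : (I → ℝ) → (ι → ℝ) := fun f i => f ⟨τ i, Finset.mem_image_of_mem τ (Finset.mem_univ i)⟩
    with hρ
  have hρm : Measurable ρ := measurable_pi_lambda _ fun i => measurable_pi_apply _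
  -- real and imaginary coordinate vectors
  set R : Ω → ι → ℝ := fun ω i => (Z (τ i) ω).re with hR
  set J : Ω → ι → ℝ := fun ω i => (Z (τ i) ω).im with hJ
  have hRm : Measurable R := measurable_pi_lambda _ fun i => Complex.measurable_re.comp (hm _)
  have hJm : Measurable J := measurable_pi_lambda _ fun i => Complex.measurable_im.comp (hm _)
  have hfdd : (fun ω i => Z (τ i) ω) =
      (fun p : (ι → ℝ) × (ι → ℝ) => fun i => (⟨p.1 i, p.2 i⟩ : ℂ)) ∘ fun ω => (R ω, J ω) := by
    funext ω i; rfl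
  -- laws of the coordinate vectors
  have hlawR : P.map R = (projectiveFamily I).map ρ := by
    have h := (hZ.re.toIsPreBrownianReal.hasLaw I).map_eq
    have hmr : Measurable fun ω => I.restrict fun t => (Z t ω).re :=
      measurable_pi_lambda _ fun t => Complex.measurable_re.comp (hm _)
    rw [show R = ρ ∘ fun ω => I.restrict fun t => (Z t ω).re from rfl,
      ← Measure.map_map hρm hmr, h]
  have hlawJ : P.map J = (projectiveFamily I).map ρ := by
    have h := (hZ.im.toIsPreBrownianReal.hasLaw I).map_eq
    have hmi : Measurable fun ω => I.restrict fun t => (Z t ω).im :=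
      measurable_pi_lambda _ fun t => Complex.measurable_im.comp (hm _)
    rw [show J = ρ ∘ fun ω => I.restrict fun t => (Z t ω).im from rfl,
      ← Measure.map_map hρm hmi, h]
  -- independence of the coordinate vectors
  have hind : IndepFun R J P := by
    have h := hZ.indepFun.comp (φ := fun (f : ℝ≥0 → ℝ) (i : ι) => f (τ i))
      (ψ := fun (f : ℝ≥0 → ℝ) (i : ι) => f (τ i))
      (measurable_pi_lambda _ fun i => measurable_pi_apply _)
      (measurable_pi_lambda _ fun i => measurable_pi_apply _)
    exact h
  rw [hfdd, ← Measure.map_map measurable_piComplexMk (hRm.prodMk hJm),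
    (indepFun_iff_map_prod_eq_prod_map_map hRm.aemeasurable hJm.aemeasurable).1 hind, hlawR, hlawJ]

/-- **The finite-dimensional distributions of planar Brownian motion are unique**: for any two
planar Brownian motions (measurable marginals) on probability spaces and finitely many times
`τ i`, the laws of `ω ↦ (Z_{τ i} ω)_i` coincide. [cite: Kallenberg2002, Lemma 13.1] -/
theorem IsBrownianComplex.map_fdd_eq [IsProbabilityMeasure P] [IsProbabilityMeasure P']
    {ι : Type*} [Fintype ι] (τ : ι → ℝ≥0) (hZ : IsBrownianComplex Z P)
    (hm : ∀ t, Measurable (Z t)) (hZ' : IsBrownianComplex Z' P') (hm' : ∀ t, Measurable (Z' t)) :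
    P.map (fun ω i => Z (τ i) ω) = P'.map (fun ω i => Z' (τ i) ω) := by
  classical
  rw [hZ.map_fdd_eq_map_prod τ hm, hZ'.map_fdd_eq_map_prod τ hm']

/-- **The law of a planar Brownian path on `C(ℝ≥0, ℂ)` is unique**: for any two planar Brownian
motions with continuous paths and measurable marginals, the path maps `ω ↦ (t ↦ Z_t ω)` have the
same law for the Borel σ-algebra of locally uniform convergence.
[cite: Kallenberg2002, Thm. 13.5] [cite: Billingsley1999, Example 1.3] -/
theorem IsBrownianComplex.map_path_eq [MeasurableSpace C(ℝ≥0, ℂ)] [BorelSpace C(ℝ≥0, ℂ)]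
    [IsProbabilityMeasure P] [IsProbabilityMeasure P'] (hZ : IsBrownianComplex Z P)
    (hm : ∀ t, Measurable (Z t)) (hc : ∀ ω, Continuous (Z · ω)) (hZ' : IsBrownianComplex Z' P')
    (hm' : ∀ t, Measurable (Z' t)) (hc' : ∀ ω, Continuous (Z' · ω)) :
    P.map (fun ω => (⟨fun t => Z t ω, hc ω⟩ : C(ℝ≥0, ℂ))) =
      P'.map (fun ω => (⟨fun t => Z' t ω, hc' ω⟩ : C(ℝ≥0, ℂ))) := by
  have hpm : Measurable fun ω => (⟨fun t => Z t ω, hc ω⟩ : C(ℝ≥0, ℂ)) := by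
    have := measurable_continuousMap_of_eval (Φ := fun ω => (⟨fun t => Z t ω, hc ω⟩ : C(ℝ≥0, ℂ)))
      fun a => hm a
    rwa [← BorelSpace.measurable_eq] at this
  have hpm' : Measurable fun ω => (⟨fun t => Z' t ω, hc' ω⟩ : C(ℝ≥0, ℂ)) := by
    have := measurable_continuousMap_of_eval (Φ := fun ω => (⟨fun t => Z' t ω, hc' ω⟩ : C(ℝ≥0, ℂ)))
      fun a => hm' a
    rwa [← BorelSpace.measurable_eq] at this
  haveI : IsFiniteMeasure (P.map fun ω => (⟨fun t => Z t ω, hc ω⟩ : C(ℝ≥0, ℂ))) :=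
    Measure.isFiniteMeasure_map _ _
  refine measure_continuousMap_ext_of_fdd fun I => ?_
  have hres : Measurable fun (f : C(ℝ≥0, ℂ)) (i : I) => f i :=
    measurable_pi_lambda _ fun i => (continuous_eval_const (i : ℝ≥0)).measurable
  rw [Measure.map_map hres hpm, Measure.map_map hres hpm']
  exact hZ.map_fdd_eq (fun i : I => (i : ℝ≥0)) hm hZ' hm'

/-- **The law of a planar Brownian path on `C([0,1], ℂ)` is unique**: the same for the paths
restricted to the unit time interval, `ω ↦ (t ↦ Z_t ω)_{t ∈ [0,1]}` (uniform topology), the path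
space of the planar invariance principles (`Edwards2D.scaledPath`, `Edwards2D.Stoll1989_invariance`).
[cite: Kallenberg2002, Thm. 13.5] [cite: Billingsley1999, Example 1.3] -/
theorem IsBrownianComplex.map_unitIntervalPath_eq [MeasurableSpace C(unitInterval, ℂ)]
    [BorelSpace C(unitInterval, ℂ)] [IsProbabilityMeasure P] [IsProbabilityMeasure P']
    (hZ : IsBrownianComplex Z P) (hm : ∀ t, Measurable (Z t)) (hc : ∀ ω, Continuous (Z · ω))
    (hZ' : IsBrownianComplex Z' P') (hm' : ∀ t, Measurable (Z' t))
    (hc' : ∀ ω, Continuous (Z' · ω)) :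
    P.map (fun ω => (⟨fun t : unitInterval => Z (Real.toNNReal (t : ℝ)) ω,
        (hc ω).comp (continuous_real_toNNReal.comp continuous_subtype_val)⟩ : C(unitInterval, ℂ))) =
      P'.map (fun ω => (⟨fun t : unitInterval => Z' (Real.toNNReal (t : ℝ)) ω,
        (hc' ω).comp (continuous_real_toNNReal.comp continuous_subtype_val)⟩ :
          C(unitInterval, ℂ))) := by
  set π : Ω → C(unitInterval, ℂ) := fun ω => ⟨fun t : unitInterval => Z (Real.toNNReal (t : ℝ)) ω,
    (hc ω).comp (continuous_real_toNNReal.comp continuous_subtype_val)⟩ with hπ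
  set π' : Ω' → C(unitInterval, ℂ) := fun ω => ⟨fun t : unitInterval => Z' (Real.toNNReal (t : ℝ)) ω,
    (hc' ω).comp (continuous_real_toNNReal.comp continuous_subtype_val)⟩ with hπ'
  have hpm : Measurable π := by
    have := measurable_continuousMap_of_eval (Φ := π) fun a => hm _
    rwa [← BorelSpace.measurable_eq] at this
  have hpm' : Measurable π' := by
    have := measurable_continuousMap_of_eval (Φ := π') fun a => hm' _
    rwa [← BorelSpace.measurable_eq] at this
  haveI : IsFiniteMeasure (P.map π) := Measure.isFiniteMeasure_map _ _
  refine measure_continuousMap_ext_of_fdd fun I => ?_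
  have hres : Measurable fun (f : C(unitInterval, ℂ)) (i : I) => f i :=
    measurable_pi_lambda _ fun i => (continuous_eval_const (i : unitInterval)).measurable
  rw [Measure.map_map hres hpm, Measure.map_map hres hpm']
  exact hZ.map_fdd_eq (fun i : I => Real.toNNReal ((i : unitInterval) : ℝ)) hm hZ' hm'

end Literature.Probability.Process

end
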